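import Summits.HubbardSuperconductivity.HubbardSuperconductivity.Theorems.NodalWardXYVisonPairCostSymbolDefs
import Summits.HubbardSuperconductivity.HubbardSuperconductivity.Theorems.NodalWardXYNodalPropagatorDecayGeometry

/-!
# Line-integral bounds for the free `d`-wave BdG symbol: crux `VisonPairCost`
# (stmt-HubbardSuperconductivity-1266), line `Sketch`, stub `stub_lineIntegralBounds`

Statement (S-2) `LineIntegralBounds` of `NodalWardXYVisonPairCostSymbolDefs`: for `μ ∈ (−4,4)` and `Δ₀ > 0` there
is `C ≥ 0` such that for all `t > 0` and all `k₂`, writing `D(k) = symbDen μ Δ₀ t k k₂` and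
`ε = lineEps μ Δ₀ t k₂`,

  `∫₀^{2π} dk / D(k) ≤ C / ε`,   `∫₀^{2π} dk / (D(k) √D(k)) ≤ C / ε²`.

Proof.
* Node angle `n₀ = arccos(−μ/4) ∈ (0,π)`, `cos n₀ = −μ/4`; by `NodalDecay.abs_cos_sub_cos_ge` there is `κ > 0`
  with `κ·||θ| − n₀| ≤ |cos θ − cos n₀|` for `|θ| ≤ π`.  Put `c₁ = coneSq Δ₀ · κ² > 0`.
* Cone inequality `symbDen_ge_line`: `D(k) ≥ coneSq Δ₀ (cos k + μ/4)² + ε²`; hence `D(k) ≥ c₁ (k − n₀)² + ε²` on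
  `[0,π]` and, by `cos (k − 2π) = cos k`, `D(k) ≥ c₁ (k − (2π − n₀))² + ε²` on `[π, 2π]`; also `D ≥ ε² > 0`.
* `arctan` antiderivative: `∫_{lo}^{hi} dk / (c (k − a)² + e²) = [arctan (√c (k − a)/e)]_{lo}^{hi} / (√c e) ≤ π/(√c e)`
  (`integral_inv_quad_le`), so each half of `[0, 2π]` contributes `≤ π/(√c₁ ε)`:
  `∫₀^{2π} dk/D ≤ (2π/√c₁)/ε`.
* `√D ≥ ε` gives `1/(D√D) ≤ ε⁻¹ · (1/D)` pointwise, whence the second bound with the same constant `C = 2π/√c₁`.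
-/

noncomputable section

-- tree namespace Summit.HubbardSuperconductivity.HubbardSuperconductivity (D-0017)
set_option linter.dupNamespace false

namespace Summit.HubbardSuperconductivity.HubbardSuperconductivity.Theorems.VisonPairCost

open Summit.HubbardSuperconductivity.HubbardSuperconductivity.Theses.NodalWardXY
open MeasureTheory intervalIntegral

/-- `arctan` antiderivative bound: `∫_{lo}^{hi} dk / (c (k − a)² + e²) ≤ π / (√c · e)` for `c, e > 0`
(the antiderivative is `arctan (√c (k − a) / e) / (√c e)` and `|arctan| < π/2`). -/
private theorem integral_inv_quad_le {c e : ℝ} (hc : 0 < c) (he : 0 < e) (a lo hi : ℝ) :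
    ∫ k in lo..hi, 1 / (c * (k - a) ^ 2 + e ^ 2) ≤ Real.pi / (Real.sqrt c * e) := by
  obtain ⟨s, hs, rfl⟩ : ∃ s : ℝ, 0 < s ∧ s ^ 2 = c :=
    ⟨Real.sqrt c, Real.sqrt_pos.2 hc, Real.sq_sqrt hc.le⟩
  rw [Real.sqrt_sq hs.le]
  have hse : s * e ≠ 0 := (mul_pos hs he).ne'
  have hq : ∀ k : ℝ, 0 < s ^ 2 * (k - a) ^ 2 + e ^ 2 := fun k => by positivity
  -- the antiderivative `F k = arctan (s (k − a) / e)` of `s e / (s² (k − a)² + e²)`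
  have hderiv : ∀ k : ℝ, HasDerivAt (fun k : ℝ => Real.arctan (s * (k - a) / e))
      (s * e / (s ^ 2 * (k - a) ^ 2 + e ^ 2)) k := by
    intro k
    have h1 : HasDerivAt (fun k : ℝ => s * (k - a) / e) (s * 1 / e) k :=
      (((hasDerivAt_id' k).sub_const a).const_mul s).div_const e
    convert h1.arctan using 1
    have h3 : (1 + (s * (k - a) / e) ^ 2) ≠ 0 := by positivity
    field_simp
    ring
  have hcont : Continuous fun k : ℝ => s * e / (s ^ 2 * (k - a) ^ 2 + e ^ 2) :=
    continuous_const.div (by fun_prop) fun k => (hq k).ne'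
  have hFTC : ∫ k in lo..hi, s * e / (s ^ 2 * (k - a) ^ 2 + e ^ 2) =
      Real.arctan (s * (hi - a) / e) - Real.arctan (s * (lo - a) / e) :=
    integral_eq_sub_of_hasDerivAt (fun k _ => hderiv k) (hcont.intervalIntegrable _ _)
  have hrw : (fun k : ℝ => 1 / (s ^ 2 * (k - a) ^ 2 + e ^ 2)) =
      fun k : ℝ => (s * e)⁻¹ * (s * e / (s ^ 2 * (k - a) ^ 2 + e ^ 2)) := by
    funext k
    rw [← mul_div_assoc, inv_mul_cancel₀ hse]
  have hpi : Real.arctan (s * (hi - a) / e) - Real.arctan (s * (lo - a) / e) ≤ Real.pi := by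
    have h1 := Real.arctan_lt_pi_div_two (s * (hi - a) / e)
    have h2 := Real.neg_pi_div_two_lt_arctan (s * (lo - a) / e)
    linarith
  calc ∫ k in lo..hi, 1 / (s ^ 2 * (k - a) ^ 2 + e ^ 2)
      = (s * e)⁻¹ * (Real.arctan (s * (hi - a) / e) - Real.arctan (s * (lo - a) / e)) := by
        rw [hrw, intervalIntegral.integral_const_mul, hFTC]
    _ ≤ (s * e)⁻¹ * Real.pi := mul_le_mul_of_nonneg_left hpi (by positivity)
    _ = Real.pi / (s * e) := inv_mul_eq_div _ _

/-- The symbol denominator `k ↦ symbDen μ Δ₀ t k k₂` is continuous. -/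
private theorem continuous_symbDen_left (μ Δ₀ t k₂ : ℝ) : Continuous fun k : ℝ => symbDen μ Δ₀ t k k₂ := by
  unfold symbDen xiS gapS
  fun_prop

/-- **(S-2) Line-integral bounds** for the free `d`-wave BdG symbol (`μ ∈ (−4,4)`, `Δ₀ > 0`): there is `C ≥ 0` with
`∫₀^{2π} dk/D(k,k₂) ≤ C/ε(k₂)` and `∫₀^{2π} dk/(D√D) ≤ C/ε(k₂)²` for all `t > 0` and `k₂`
(`D = symbDen`, `ε = lineEps`).  Registered stub of line `Sketch` of the crux `VisonPairCost`. -/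
theorem stub_lineIntegralBounds : LineIntegralBounds := by
  intro μ hμ Δ₀ hΔ₀
  obtain ⟨hμ1, hμ2⟩ := hμ
  -- the node angle `n₀ = arccos (−μ/4)` and the cosine-difference constant `κ`
  obtain ⟨n₀, hn₀pos, hn₀lt, hcosn₀⟩ : ∃ n₀ : ℝ, 0 < n₀ ∧ n₀ < Real.pi ∧ Real.cos n₀ = -μ / 4 :=
    ⟨Real.arccos (-μ / 4), Real.arccos_pos.2 (by linarith), Real.arccos_lt_pi.2 (by linarith),
      Real.cos_arccos (by linarith) (by linarith)⟩
  obtain ⟨κ, hκ, hκb⟩ := NodalDecay.abs_cos_sub_cos_ge hn₀pos hn₀lt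
  have hcone : 0 < coneSq Δ₀ := by
    unfold coneSq
    have : 0 < min 1 Δ₀ := lt_min one_pos hΔ₀
    positivity
  obtain ⟨c₁, hc₁, hc₁def⟩ : ∃ c₁ : ℝ, 0 < c₁ ∧ c₁ = coneSq Δ₀ * κ ^ 2 := ⟨_, by positivity, rfl⟩
  have hsc : 0 < Real.sqrt c₁ := Real.sqrt_pos.2 hc₁
  refine ⟨2 * Real.pi / Real.sqrt c₁, by positivity, ?_⟩
  intro t ht k₂
  set ε := lineEps μ Δ₀ t k₂ with hε_def
  have hεpos : 0 < ε := by
    rw [hε_def]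
    unfold lineEps
    apply Real.sqrt_pos.2
    have : 0 ≤ coneSq Δ₀ * (Real.cos k₂ + μ / 4) ^ 2 := by positivity
    positivity
  -- the cone inequality and its consequences
  have hDge : ∀ k : ℝ, coneSq Δ₀ * (Real.cos k + μ / 4) ^ 2 + ε ^ 2 ≤ symbDen μ Δ₀ t k k₂ := fun k =>
    symbDen_ge_line μ Δ₀ t k k₂ hΔ₀.le
  have hDε : ∀ k : ℝ, ε ^ 2 ≤ symbDen μ Δ₀ t k k₂ := fun k =>
    le_trans (le_add_of_nonneg_left (by positivity)) (hDge k)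
  have hDpos : ∀ k : ℝ, 0 < symbDen μ Δ₀ t k k₂ := fun k => lt_of_lt_of_le (by positivity) (hDε k)
  -- nodal cone bound on `|θ| ≤ π`
  have hconeθ : ∀ θ : ℝ, |θ| ≤ Real.pi → c₁ * (|θ| - n₀) ^ 2 + ε ^ 2 ≤ symbDen μ Δ₀ t θ k₂ := by
    intro θ hθ
    have h1 := hκb θ hθ
    have h2 : (κ * |(|θ| - n₀)|) ^ 2 ≤ (Real.cos θ + μ / 4) ^ 2 := by
      have e : Real.cos θ - Real.cos n₀ = Real.cos θ + μ / 4 := by rw [hcosn₀]; ring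
      rw [← e, ← sq_abs (Real.cos θ - Real.cos n₀)]
      exact pow_le_pow_left₀ (by positivity) h1 2
    have h3 : c₁ * (|θ| - n₀) ^ 2 = coneSq Δ₀ * (κ * |(|θ| - n₀)|) ^ 2 := by
      rw [hc₁def, mul_pow, sq_abs]; ring
    have h4 : coneSq Δ₀ * (κ * |(|θ| - n₀)|) ^ 2 ≤ coneSq Δ₀ * (Real.cos θ + μ / 4) ^ 2 :=
      mul_le_mul_of_nonneg_left h2 hcone.le
    linarith [hDge θ]
  -- on `[0, π]`
  have hQ1 : ∀ k ∈ Set.Icc 0 Real.pi, c₁ * (k - n₀) ^ 2 + ε ^ 2 ≤ symbDen μ Δ₀ t k k₂ := by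
    intro k hk
    have h := hconeθ k (by rw [abs_of_nonneg hk.1]; exact hk.2)
    rwa [abs_of_nonneg hk.1] at h
  -- on `[π, 2π]` (shift by `2π`)
  have hQ2 : ∀ k ∈ Set.Icc Real.pi (2 * Real.pi),
      c₁ * (k - (2 * Real.pi - n₀)) ^ 2 + ε ^ 2 ≤ symbDen μ Δ₀ t k k₂ := by
    intro k hk
    have habs : |k - 2 * Real.pi| = 2 * Real.pi - k := by
      rw [abs_of_nonpos (by linarith [hk.2])]; ring
    have h := hconeθ (k - 2 * Real.pi) (by rw [habs]; linarith [hk.1])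
    rw [habs] at h
    have hper : symbDen μ Δ₀ t (k - 2 * Real.pi) k₂ = symbDen μ Δ₀ t k k₂ := by
      simp only [symbDen, xiS, gapS, Real.cos_sub_two_pi]
    have hsq : (2 * Real.pi - k - n₀) ^ 2 = (k - (2 * Real.pi - n₀)) ^ 2 := by ring
    rw [hper, hsq] at h
    exact h
  -- integrability
  have hDcont : Continuous fun k : ℝ => symbDen μ Δ₀ t k k₂ := continuous_symbDen_left μ Δ₀ t k₂
  have hf_int : ∀ a b : ℝ, IntervalIntegrable (fun k : ℝ => 1 / symbDen μ Δ₀ t k k₂) volume a b :=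
    fun a b => (continuous_const.div hDcont fun k => (hDpos k).ne').intervalIntegrable a b
  have hg_int : ∀ x a b : ℝ,
      IntervalIntegrable (fun k : ℝ => 1 / (c₁ * (k - x) ^ 2 + ε ^ 2)) volume a b :=
    fun x a b => (continuous_const.div (by fun_prop) fun k => by positivity).intervalIntegrable a b
  -- the two halves
  have hI1 : ∫ k in (0 : ℝ)..Real.pi, 1 / symbDen μ Δ₀ t k k₂ ≤ Real.pi / (Real.sqrt c₁ * ε) := by
    calc ∫ k in (0 : ℝ)..Real.pi, 1 / symbDen μ Δ₀ t k k₂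
        ≤ ∫ k in (0 : ℝ)..Real.pi, 1 / (c₁ * (k - n₀) ^ 2 + ε ^ 2) :=
          intervalIntegral.integral_mono_on Real.pi_pos.le (hf_int _ _) (hg_int _ _ _)
            fun k hk => one_div_le_one_div_of_le (by positivity) (hQ1 k hk)
      _ ≤ Real.pi / (Real.sqrt c₁ * ε) := integral_inv_quad_le hc₁ hεpos n₀ 0 Real.pi
  have hI2 : ∫ k in Real.pi..(2 * Real.pi), 1 / symbDen μ Δ₀ t k k₂ ≤ Real.pi / (Real.sqrt c₁ * ε) := by
    calc ∫ k in Real.pi..(2 * Real.pi), 1 / symbDen μ Δ₀ t k k₂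
        ≤ ∫ k in Real.pi..(2 * Real.pi), 1 / (c₁ * (k - (2 * Real.pi - n₀)) ^ 2 + ε ^ 2) :=
          intervalIntegral.integral_mono_on (by linarith [Real.pi_pos]) (hf_int _ _) (hg_int _ _ _)
            fun k hk => one_div_le_one_div_of_le (by positivity) (hQ2 k hk)
      _ ≤ Real.pi / (Real.sqrt c₁ * ε) := integral_inv_quad_le hc₁ hεpos _ _ _
  have hsplit : ∫ k in (0 : ℝ)..(2 * Real.pi), 1 / symbDen μ Δ₀ t k k₂ =
      (∫ k in (0 : ℝ)..Real.pi, 1 / symbDen μ Δ₀ t k k₂) +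
        ∫ k in Real.pi..(2 * Real.pi), 1 / symbDen μ Δ₀ t k k₂ :=
    (intervalIntegral.integral_add_adjacent_intervals (hf_int _ _) (hf_int _ _)).symm
  have hmain : ∫ k in (0 : ℝ)..(2 * Real.pi), 1 / symbDen μ Δ₀ t k k₂ ≤ 2 * Real.pi / Real.sqrt c₁ / ε := by
    have e : 2 * Real.pi / Real.sqrt c₁ / ε = Real.pi / (Real.sqrt c₁ * ε) + Real.pi / (Real.sqrt c₁ * ε) := by
      rw [div_div]; ring
    rw [hsplit, e]
    exact add_le_add hI1 hI2
  refine ⟨hmain, ?_⟩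
  -- second bound: `1/(D√D) ≤ ε⁻¹/D` since `√D ≥ ε`
  have hpt : ∀ k : ℝ, 1 / (symbDen μ Δ₀ t k k₂ * Real.sqrt (symbDen μ Δ₀ t k k₂)) ≤
      ε⁻¹ * (1 / symbDen μ Δ₀ t k k₂) := by
    intro k
    have hsq : ε ≤ Real.sqrt (symbDen μ Δ₀ t k k₂) := by
      rw [← Real.sqrt_sq hεpos.le]; exact Real.sqrt_le_sqrt (hDε k)
    calc 1 / (symbDen μ Δ₀ t k k₂ * Real.sqrt (symbDen μ Δ₀ t k k₂))
        ≤ 1 / (symbDen μ Δ₀ t k k₂ * ε) :=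
          one_div_le_one_div_of_le (mul_pos (hDpos k) hεpos) (mul_le_mul_of_nonneg_left hsq (hDpos k).le)
      _ = ε⁻¹ * (1 / symbDen μ Δ₀ t k k₂) := by
          rw [one_div, mul_inv, one_div, mul_comm]
  have hh_int : IntervalIntegrable
      (fun k : ℝ => 1 / (symbDen μ Δ₀ t k k₂ * Real.sqrt (symbDen μ Δ₀ t k k₂))) volume 0 (2 * Real.pi) :=
    (continuous_const.div (hDcont.mul hDcont.sqrt) fun k =>
      (mul_pos (hDpos k) (Real.sqrt_pos.2 (hDpos k))).ne').intervalIntegrable _ _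
  calc ∫ k in (0 : ℝ)..(2 * Real.pi), 1 / (symbDen μ Δ₀ t k k₂ * Real.sqrt (symbDen μ Δ₀ t k k₂))
      ≤ ∫ k in (0 : ℝ)..(2 * Real.pi), ε⁻¹ * (1 / symbDen μ Δ₀ t k k₂) :=
        intervalIntegral.integral_mono_on (by positivity) hh_int ((hf_int _ _).const_mul _) fun k _ => hpt k
    _ = ε⁻¹ * ∫ k in (0 : ℝ)..(2 * Real.pi), 1 / symbDen μ Δ₀ t k k₂ :=
        intervalIntegral.integral_const_mul _ _
    _ ≤ ε⁻¹ * (2 * Real.pi / Real.sqrt c₁ / ε) := mul_le_mul_of_nonneg_left hmain (by positivity)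
    _ = 2 * Real.pi / Real.sqrt c₁ / ε ^ 2 := by ring

end Summit.HubbardSuperconductivity.HubbardSuperconductivity.Theorems.VisonPairCost

end
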